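import Literature.Computability.Cryptography.CubicClassTableSemPow
import HarnessLib

/-!
# Semantics of the class-group table, IV: baby steps along a chain, the ladder base and the ladder

Topic `Computability/Cryptography`; theorem-only sequel of `CubicClassTableSemPow.lean` (crux
`LinnikCubicClassGroups.PureCubicClassGroupFBQP`, line `arakelov-giant-step-cycle`). In the context of that file, with a
unit `ε`, `σ₁ ε > 1` (for the Voronoi successor):

* `WalkFns.stepc_chain` — ONE UNGUARDED BABY STEP along the Voronoi chain `θ` of any nonzero ideal `A`: if `st` codes
  `θ(i)⁻¹ A` then `stepc st` codes `θ(i+1)⁻¹ A` and adds a certified log of the gap,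
  `0 < log σ₁θ(i+1) − log σ₁θ(i) ≤ log(3√|d_K|)`;
* `WalkFns.stepc_iterate_chain` — `k` steps: codes `θ(i+k)⁻¹ A`, position advanced by `2^prec (log σ₁θ(i+k) − log σ₁θ(i)) ± k`;
* `WalkFns.hbase_sem` — the LADDER BASE `h = stepc^[s₀] (ord, 0)` codes the reduced principal ideal `θ₀(s₀)⁻¹ 𝓞_K` of the
  principal chain `θ₀` from `1`, at computed position `p₀`, `|p₀ − 2^prec log σ₁θ₀(s₀)| ≤ s₀`;
* `WalkFns.ladder_sem` — the LADDER `g_i = (x ↦ x ⋆ x)^[i] h` codes reduced principal ideals `η_i⁻¹ 𝓞_K`, `σ₁ η_i > 0`, with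
  computed positions `p_{i+1} = 2 p_i + l_i`, `|l_i| ≤ 2^prec · 2 log(3√|d_K|) + 1`, and `|p_i − 2^prec log σ₁ η_i| ≤ 2^i (s₀ + 1) − 1`.
[Buchmann–Williams 1988, §3; Hallgren 2005, §4]

## References

* J. Buchmann, H. C. Williams, Math. Comp. 50 (1988), §3. [BuchmannWilliams1988]
* S. Hallgren, STOC 2005, §4. [Hallgren2005]
-/

noncomputable section

namespace Literature.Computability.Cryptography

namespace CubicClassTable

open Literature.NumberTheory.CubicFields Literature.NumberTheory.CubicFields.PureCubicCodes
open scoped NumberField nonZeroDivisors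
open NumberField

namespace WalkFns

section Ladder

variable {K : Type*} [Field K] [NumberField K] {θ : K} {σ₁ : K →+* ℝ} {σ₂ : K →+* ℂ} {F : WalkFns} {I : Inst}
variable (hdeg : Module.finrank ℚ K = 3) (hσ₂ : ∃ z : K, starRingEnd ℂ (σ₂ z) ≠ σ₂ z)
  (ε : (𝓞 K)ˣ) (hε : 1 < σ₁ (algebraMap (𝓞 K) K ε))
  (hab : Squarefree (I.a * I.b)) (hab1 : I.a * I.b ≠ 1) (hθ : θ ^ 3 = ((I.a * I.b ^ 2 : ℕ) : K))
  (hred : RedSem F I.a I.b K θ σ₁ σ₂) (hprod : ProdSpec I.a I.b K θ F.latProd)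
  {cap : ℕ} (hcap : (243 * I.a ^ 2 * I.b ^ 2) ^ 2 ≤ cap) (hprec : 4 * Nat.size (I.a * I.b) + 8 ≤ I.prec)
  (hord : Canon I.ord) (hordm : ∀ φ : K, Mem θ I.b I.ord φ ↔ IsIntegral ℤ φ)

include hdeg hσ₂ hε hab hab1 hθ hred hcap in
/-- **One unguarded baby step along a chain.** For a nonzero `A`, `x₀ ∈ posRelMinima A`, `θ = voronoiChain A x₀`: if
`st.1` is the canonical code of `θ(i)⁻¹ A` then `(stepc st).1` is the canonical code of `θ(i+1)⁻¹ A` and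
`(stepc st).2 − st.2` is within `1` of `2^prec (log σ₁θ(i+1) − log σ₁θ(i))`, a gap in `(0, log (3√|d_K|)]`.
[cite: BuchmannWilliams1988, §3] -/
theorem stepc_chain {A : FractionalIdeal (𝓞 K)⁰ K} {x₀ : K} (hx₀ : x₀ ∈ posRelMinima σ₁ σ₂ A) (i : ℤ)
    {st : PLat} (hc : Canon st.1)
    (hm : ∀ φ : K, Mem θ I.b st.1 φ ↔
      φ ∈ FractionalIdeal.spanSingleton (𝓞 K)⁰ (voronoiChain σ₁ σ₂ A x₀ i)⁻¹ * A) :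
    Canon (F.stepc I cap st).1 ∧
      (∀ φ : K, Mem θ I.b (F.stepc I cap st).1 φ ↔
        φ ∈ FractionalIdeal.spanSingleton (𝓞 K)⁰ (voronoiChain σ₁ σ₂ A x₀ (i + 1))⁻¹ * A) ∧
      |(((F.stepc I cap st).2 - st.2 : ℤ) : ℝ) - 2 ^ I.prec *
          (Real.log (σ₁ (voronoiChain σ₁ σ₂ A x₀ (i + 1))) - Real.log (σ₁ (voronoiChain σ₁ σ₂ A x₀ i)))| ≤ 1 ∧
      0 < Real.log (σ₁ (voronoiChain σ₁ σ₂ A x₀ (i + 1))) - Real.log (σ₁ (voronoiChain σ₁ σ₂ A x₀ i)) ∧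
      Real.log (σ₁ (voronoiChain σ₁ σ₂ A x₀ (i + 1))) - Real.log (σ₁ (voronoiChain σ₁ σ₂ A x₀ i)) ≤
        Real.log (3 * Real.sqrt |(discr K : ℝ)|) := by
  set J : FractionalIdeal (𝓞 K)⁰ K := FractionalIdeal.spanSingleton (𝓞 K)⁰ (voronoiChain σ₁ σ₂ A x₀ i)⁻¹ * A with hJ
  have hθi := voronoiChain_mem hdeg hσ₂ ε hε hx₀ i
  have hθi1 := voronoiChain_mem hdeg hσ₂ ε hε hx₀ (i + 1)
  have h1 : (1 : K) ∈ posRelMinima σ₁ σ₂ J := one_mem_posRelMinima_inv_mul hθi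
  obtain ⟨hγJ, hγpos, hγ1, hγmin, hstep⟩ := voronoiChain_cylinder_step hdeg hσ₂ ε hε hx₀ i
  obtain ⟨hsJ, hspos, hs1, hsmin⟩ := voronoiSucc_one_mem_cylinder hdeg hσ₂ ε hε h1
  have hγs : voronoiSucc σ₁ σ₂ J 1 = (voronoiChain σ₁ σ₂ A x₀ i)⁻¹ * voronoiChain σ₁ σ₂ A x₀ (i + 1) :=
    σ₁.injective (le_antisymm (hsmin _ hγJ hγpos hγ1) (hγmin _ hsJ hspos hs1))
  obtain ⟨hcan, hmem, -, hlt, -, hlpos, hlle, hlog⟩ := red_sem_reduced hdeg hσ₂ hred ε hε hc hm h1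
  have hcap1 : 243 * I.a ^ 2 * I.b ^ 2 ≤ cap := le_trans (Nat.le_self_pow two_ne_zero _) hcap
  have hJ0 : J ≠ 0 := fun h => one_ne_zero ((FractionalIdeal.mem_zero_iff (𝓞 K)⁰).mp (h ▸ h1.1.1))
  have hredc : F.redc I cap st.1 = F.red I st.1 := redc_eq_red hdeg hσ₂ hab hab1 hθ hred rfl hcap1 hJ0 hc hm
  have hlogeq : Real.log (σ₁ (voronoiSucc σ₁ σ₂ J 1)) =
      Real.log (σ₁ (voronoiChain σ₁ σ₂ A x₀ (i + 1))) - Real.log (σ₁ (voronoiChain σ₁ σ₂ A x₀ i)) := by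
    rw [hγs, map_mul, map_inv₀, Real.log_mul (inv_ne_zero hθi.2.ne') hθi1.2.ne', Real.log_inv]; ring
  have hfst : (F.stepc I cap st).1 = (F.red I st.1).1 := by unfold stepc; rw [hredc]
  have hsnd : (F.stepc I cap st).2 - st.2 = (F.red I st.1).2 := by unfold stepc; rw [hredc]; ring
  refine ⟨hfst ▸ hcan, fun φ => ?_, ?_, hlogeq ▸ hlpos, hlogeq ▸ hlle⟩
  · rw [hfst, hmem φ, hγs, hstep]
  · rw [hsnd, ← hlogeq]; exact hlog

include hdeg hσ₂ hε hab hab1 hθ hred hcap in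
/-- **Iterated unguarded baby steps**: `k` steps from a code of `θ(i)⁻¹ A` give the code of `θ(i+k)⁻¹ A`, with the
position advanced by `2^prec (log σ₁θ(i+k) − log σ₁θ(i)) ± k`. [cite: BuchmannWilliams1988, §3] -/
theorem stepc_iterate_chain {A : FractionalIdeal (𝓞 K)⁰ K} {x₀ : K} (hx₀ : x₀ ∈ posRelMinima σ₁ σ₂ A) (i : ℤ)
    {st : PLat} (hc : Canon st.1)
    (hm : ∀ φ : K, Mem θ I.b st.1 φ ↔
      φ ∈ FractionalIdeal.spanSingleton (𝓞 K)⁰ (voronoiChain σ₁ σ₂ A x₀ i)⁻¹ * A) (k : ℕ) :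
    Canon ((F.stepc I cap)^[k] st).1 ∧
      (∀ φ : K, Mem θ I.b ((F.stepc I cap)^[k] st).1 φ ↔
        φ ∈ FractionalIdeal.spanSingleton (𝓞 K)⁰ (voronoiChain σ₁ σ₂ A x₀ (i + k))⁻¹ * A) ∧
      |((((F.stepc I cap)^[k] st).2 - st.2 : ℤ) : ℝ) - 2 ^ I.prec *
          (Real.log (σ₁ (voronoiChain σ₁ σ₂ A x₀ (i + k))) - Real.log (σ₁ (voronoiChain σ₁ σ₂ A x₀ i)))| ≤ k := by
  induction k with
  | zero => exact ⟨hc, by simpa using hm, by simp⟩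
  | succ k ih =>
    obtain ⟨hc', hm', herr⟩ := ih
    rw [Function.iterate_succ_apply']
    obtain ⟨hc'', hm'', herr', -, -⟩ := stepc_chain hdeg hσ₂ ε hε hab hab1 hθ hred hcap hx₀ (i + k) hc' hm'
    refine ⟨hc'', by rw [show (i : ℤ) + ((k + 1 : ℕ) : ℤ) = i + k + 1 by push_cast; ring]; exact hm'', ?_⟩
    rw [show (i : ℤ) + ((k + 1 : ℕ) : ℤ) = i + k + 1 by push_cast; ring]
    have e : (((F.stepc I cap ((F.stepc I cap)^[k] st)).2 - st.2 : ℤ) : ℝ) =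
        (((F.stepc I cap ((F.stepc I cap)^[k] st)).2 - ((F.stepc I cap)^[k] st).2 : ℤ) : ℝ) +
          ((((F.stepc I cap)^[k] st).2 - st.2 : ℤ) : ℝ) := by push_cast; ring
    rw [e, abs_le]
    rw [abs_le] at herr herr'
    push_cast at herr herr' ⊢
    constructor <;> linarith [herr.1, herr.2, herr'.1, herr'.2]

include hdeg hσ₂ hε hab hab1 hθ hred hcap hord hordm in
/-- **The ladder base**: `hbase = stepc^[s₀] (ord, 0)` codes `θ₀(s₀)⁻¹ 𝓞_K` for the principal chain `θ₀` from `1`, at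
position `p₀` with `|p₀ − 2^prec log σ₁θ₀(s₀)| ≤ s₀`. [cite: BuchmannWilliams1988, §3] -/
theorem hbase_sem :
    Canon (F.hbase I cap).1 ∧
      (∀ φ : K, Mem θ I.b (F.hbase I cap).1 φ ↔ φ ∈ FractionalIdeal.spanSingleton (𝓞 K)⁰
        (voronoiChain σ₁ σ₂ (1 : FractionalIdeal (𝓞 K)⁰ K) 1 (I.s₀ : ℤ))⁻¹ * 1) ∧
      (1 : K) ∈ posRelMinima σ₁ σ₂ (FractionalIdeal.spanSingleton (𝓞 K)⁰
        (voronoiChain σ₁ σ₂ (1 : FractionalIdeal (𝓞 K)⁰ K) 1 (I.s₀ : ℤ))⁻¹ * 1) ∧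
      0 < σ₁ (voronoiChain σ₁ σ₂ (1 : FractionalIdeal (𝓞 K)⁰ K) 1 (I.s₀ : ℤ)) ∧
      |((F.hbase I cap).2 : ℝ) - 2 ^ I.prec *
        Real.log (σ₁ (voronoiChain σ₁ σ₂ (1 : FractionalIdeal (𝓞 K)⁰ K) 1 (I.s₀ : ℤ)))| ≤ I.s₀ := by
  have h1 : (1 : K) ∈ posRelMinima σ₁ σ₂ (1 : FractionalIdeal (𝓞 K)⁰ K) := one_mem_posRelMinima_one hdeg hσ₂
  have hm0 : ∀ φ : K, Mem θ I.b (I.ord, (0 : ℤ)).1 φ ↔ φ ∈ FractionalIdeal.spanSingleton (𝓞 K)⁰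
      (voronoiChain σ₁ σ₂ (1 : FractionalIdeal (𝓞 K)⁰ K) 1 0)⁻¹ * 1 := fun φ => by
    rw [voronoiChain_zero, inv_one, FractionalIdeal.spanSingleton_one, one_mul, mem_one_iff_isIntegral]
    exact hordm φ
  obtain ⟨hc, hm, herr⟩ := stepc_iterate_chain hdeg hσ₂ ε hε hab hab1 hθ hred hcap h1 0 hord hm0 I.s₀
  rw [zero_add] at hm herr
  have hmem := voronoiChain_mem hdeg hσ₂ ε hε h1 (I.s₀ : ℤ)
  refine ⟨hc, hm, one_mem_posRelMinima_inv_mul hmem, hmem.2, ?_⟩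
  rw [voronoiChain_zero, map_one, Real.log_one] at herr
  simp only [sub_zero] at herr
  exact herr

include hdeg hσ₂ hε hab hab1 hθ hred hprod hcap hprec hord hordm in
/-- **The ladder** `g_i = (x ↦ x ⋆ x)^[i] h`: reduced principal labels `η_i⁻¹ 𝓞_K` (`σ₁ η_i > 0`), computed positions
with `|p_{i+1} − 2 p_i| ≤ 2^prec · 2 log(3√|d_K|) + 1` and true positions `|p_i − 2^prec log σ₁ η_i| ≤ 2^i (s₀ + 1) − 1`.
[cite: BuchmannWilliams1988, §3] -/
theorem ladder_sem (i : ℕ) :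
    ∃ η : K, 0 < σ₁ η ∧ Canon (F.ladder I cap i).1 ∧
      (∀ φ : K, Mem θ I.b (F.ladder I cap i).1 φ ↔ φ ∈ FractionalIdeal.spanSingleton (𝓞 K)⁰ η⁻¹ * 1) ∧
      (1 : K) ∈ posRelMinima σ₁ σ₂ (FractionalIdeal.spanSingleton (𝓞 K)⁰ η⁻¹ * 1) ∧
      |((F.ladder I cap i).2 : ℝ) - 2 ^ I.prec * Real.log (σ₁ η)| ≤ 2 ^ i * (I.s₀ + 1) - 1 ∧
      |((F.ladder I cap (i + 1)).2 : ℝ) - 2 * (F.ladder I cap i).2| ≤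
        2 ^ I.prec * (2 * Real.log (3 * Real.sqrt |(discr K : ℝ)|)) + 1 := by
  induction i with
  | zero =>
    obtain ⟨hc, hm, hone, hpos, herr⟩ := hbase_sem hdeg hσ₂ ε hε hab hab1 hθ hred hcap hord hordm
    refine ⟨_, hpos, hc, hm, hone, by norm_num; exact herr, ?_⟩
    obtain ⟨γ, -, -, -, -, hl, hlg⟩ := starCc_mul_sem hdeg hσ₂ hab hab1 hθ hred hprod hcap hprec hc hm hone hc hm hone
    change |((F.starCc I cap (F.hbase I cap) (F.hbase I cap)).2 : ℝ) - 2 * (F.hbase I cap).2| ≤ _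
    have e : ((F.starCc I cap (F.hbase I cap) (F.hbase I cap)).2 : ℝ) - 2 * (F.hbase I cap).2 =
        (((F.starCc I cap (F.hbase I cap) (F.hbase I cap)).2 - (F.hbase I cap).2 - (F.hbase I cap).2 : ℤ) : ℝ) := by
      push_cast; ring
    rw [e, abs_le]
    rw [abs_le] at hl hlg
    have h2 : (0 : ℝ) ≤ 2 ^ I.prec := by positivity
    constructor <;> nlinarith [hl.1, hl.2, hlg.1, hlg.2, h2]
  | succ i ih =>
    obtain ⟨η, hη, hc, hm, hone, herr, -⟩ := ih
    obtain ⟨γ, hγ, hc', hm', hone', hl, hlg⟩ :=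
      starCc_mul_sem hdeg hσ₂ hab hab1 hθ hred hprod hcap hprec hc hm hone hc hm hone
    have hlad : F.ladder I cap (i + 1) = F.starCc I cap (F.ladder I cap i) (F.ladder I cap i) := by
      change (fun x => F.starCc I cap x x)^[i + 1] (F.hbase I cap) = _
      rw [Function.iterate_succ_apply']; rfl
    have hlad2 : F.ladder I cap (i + 1 + 1) = F.starCc I cap (F.ladder I cap (i + 1)) (F.ladder I cap (i + 1)) := by
      change (fun x => F.starCc I cap x x)^[i + 1 + 1] (F.hbase I cap) = _
      rw [Function.iterate_succ_apply']; rfl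
    rw [mul_one] at hm' hone'
    refine ⟨η * η * γ, by rw [map_mul, map_mul]; positivity, hlad ▸ hc', fun φ => by rw [hlad]; exact hm' φ, hone', ?_, ?_⟩
    · have hlog : Real.log (σ₁ (η * η * γ)) = 2 * Real.log (σ₁ η) + Real.log (σ₁ γ) := by
        rw [map_mul, map_mul, Real.log_mul (by positivity) hγ.ne', Real.log_mul hη.ne' hη.ne']; ring
      rw [hlog, hlad]
      have e : ((F.starCc I cap (F.ladder I cap i) (F.ladder I cap i)).2 : ℝ) =
          (((F.starCc I cap (F.ladder I cap i) (F.ladder I cap i)).2 - (F.ladder I cap i).2 - (F.ladder I cap i).2 : ℤ) : ℝ) +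
            (F.ladder I cap i).2 + (F.ladder I cap i).2 := by push_cast; ring
      rw [e, abs_le]
      rw [abs_le] at herr hl
      push_cast at herr hl ⊢
      have hp : (2 : ℝ) ^ (i + 1) = 2 * 2 ^ i := by ring
      constructor <;> nlinarith [herr.1, herr.2, hl.1, hl.2, hp]
    · obtain ⟨γ', -, -, -, -, hl', hlg'⟩ :=
        starCc_mul_sem hdeg hσ₂ hab hab1 hθ hred hprod hcap hprec (hlad ▸ hc') (fun φ => by rw [hlad]; exact hm' φ) hone'
          (hlad ▸ hc') (fun φ => by rw [hlad]; exact hm' φ) hone'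
      rw [hlad2]
      have e : ((F.starCc I cap (F.ladder I cap (i + 1)) (F.ladder I cap (i + 1))).2 : ℝ) - 2 * (F.ladder I cap (i + 1)).2 =
          (((F.starCc I cap (F.ladder I cap (i + 1)) (F.ladder I cap (i + 1))).2 - (F.ladder I cap (i + 1)).2 -
            (F.ladder I cap (i + 1)).2 : ℤ) : ℝ) := by push_cast; ring
      rw [e, abs_le]
      rw [abs_le] at hl' hlg'
      have h2 : (0 : ℝ) ≤ 2 ^ I.prec := by positivity
      constructor <;> nlinarith [hl'.1, hl'.2, hlg'.1, hlg'.2, h2]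

end Ladder

end WalkFns


section Summary

/-- **Summary (registered helper of the class-group stage)**: the ladder of reduced principal labels and its computed positions. [cite: BuchmannWilliams1988, §3] -/
theorem cubicClassTable_ladder_sem : ∀ (K : Type) [Field K] [NumberField K], Module.finrank ℚ K = 3 → ∀ (θ : K) (σ₁ : K →+* ℝ) (σ₂ : K →+* ℂ), (∃ z : K, starRingEnd ℂ (σ₂ z) ≠ σ₂ z) → ∀ (ε : (𝓞 K)ˣ), 1 < σ₁ (algebraMap (𝓞 K) K ε) → ∀ (F : CubicClassTable.WalkFns) (I : CubicClassTable.Inst), Squarefree (I.a * I.b) → I.a * I.b ≠ 1 → θ ^ 3 = ((I.a * I.b ^ 2 : ℕ) : K) → CubicClassTable.RedSem F I.a I.b K θ σ₁ σ₂ → CubicClassTable.ProdSpec I.a I.b K θ F.latProd → ∀ (cap : ℕ), (243 * I.a ^ 2 * I.b ^ 2) ^ 2 ≤ cap → 4 * Nat.size (I.a * I.b) + 8 ≤ I.prec → PureCubicCodes.Canon I.ord → (∀ φ : K, PureCubicCodes.Mem θ I.b I.ord φ ↔ IsIntegral ℤ φ) → ∀ (i : ℕ), ∃ η : K, 0 <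 σ₁ η ∧ PureCubicCodes.Canon (F.ladder I cap i).1 ∧ (∀ φ : K, PureCubicCodes.Mem θ I.b (F.ladder I cap i).1 φ ↔ φ ∈ FractionalIdeal.spanSingleton (𝓞 K)⁰ η⁻¹ * 1) ∧ (1 : K) ∈ posRelMinima σ₁ σ₂ (FractionalIdeal.spanSingleton (𝓞 K)⁰ η⁻¹ * 1) ∧ |((F.ladder I cap i).2 : ℝ) - 2 ^ I.prec * Real.log (σ₁ η)| ≤ 2 ^ i * (I.s₀ + 1) - 1 ∧ |((F.ladder I cap (i + 1)).2 : ℝ) - 2 * (F.ladder I cap i).2| ≤ 2 ^ I.prec * (2 * Real.log (3 * Real.sqrt |(NumberField.discr K : ℝ)|)) + 1 :=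
  fun _ _ _ hdeg _ _ _ hσ₂ ε hε _ _ hab hab1 hθ hred hprod _ hcap hprec hord hordm i =>
    WalkFns.ladder_sem hdeg hσ₂ ε hε hab hab1 hθ hred hprod hcap hprec hord hordm i

end Summary

end CubicClassTable

end Literature.Computability.Cryptography
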